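/-
Origin: expansion seat `prover-pub-hodgecm-mc-binder-1-0`, handover #2 2026-08-18T18:53Z md5 03d329af725cad2f1c573f72c0850fb0 (NEW, 247 l.; rewrites import McB1.IchinoFockKTypes -> HodgeCM.Literature.IchinoFockKTypes x1; audited names: HodgeCM.Literature.Ichino2022.WorkedLines.corresponds_trivial_iff_posLine, HodgeCM.Literature.Ichino2022.WorkedLines.corresponds_pPlus_iff_posLine, HodgeCM.Literature.Ichino2022.WorkedLines.not_corresponds_pPlus_negLine) (`HOME/mc/pub-hodgecm-mc-binder-1/lean/McB1/IchinoFockKTypesLines.lean`, md5 03d329af, 247 lines);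
landed by the packager successor (mc-unitary-1-g3, gen-8 kit) in gate run 32 as `HodgeCM/Literature/IchinoFockKTypesLines.lean` (import ^import McB1\.IchinoFockKTypes[ \t]*$→import HodgeCM.Literature.IchinoFockKTypes ×1).
-/
/-
Copyright (c) 2026 the pub-hodgecm formalisation cell (harness21).  New file, not vendored (same author as the tree copy).
Origin: HOME/mc/pub-hodgecm-mc-binder-1/lean/McB1/IchinoFockKTypesLines.lean — session prover-pub-hodgecm-mc-binder-1-0 (unit
pub-hodgecm-mc-binder-1, MODEL-CONSTRUCTION sub-cell, BINDER PROVER hbr/hQ/hch).  Intended final place: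
`HodgeCM/Literature/IchinoFockKTypesLines.lean` (module `HodgeCM.Literature.IchinoFockKTypesLines`); PACKAGE COPY of the hub-tree module
`Literature.RepresentationTheory.Ichino2022.FockKTypeWorkedLines` (proposed to the hub gate by the same seat; the package cannot
import the tree — CONTRIBUTING §1), namespace `HodgeCM.Literature.Ichino2022` instead of
`Literature.RepresentationTheory.Ichino2022`, otherwise byte-for-byte the same declarations.  Imports: `McB1.IchinoFockKTypes` ↦ `HodgeCM.Literature.IchinoFockKTypes` (ONE rewrite).
KIND: PRINT transcription (dictionary level, nothing asserted) + kernel arithmetic.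
-/
import Summits.HodgeConjecture.HodgeCM.Literature.IchinoFockKTypes

set_option autoImplicit false

/-!
# Ichino (2022) Lemma 7.10 — worked lines I: hermitian LINES against `U(r)` (compact) and `U(2,1)`

Companion of `HodgeCM.Literature.IchinoFockKTypes` (tree: `Literature.RepresentationTheory.Ichino2022.FockKTypeCorrespondence`) (verbatim transcription of
A. Ichino, Adv. Math. 398 (2022) 108188 = arXiv:2008.06174, §4.1 + §7.5 Lemma 7.10 [Ichino2022ThetaReal]).
Four SPECIAL CASES of Lemma 7.10 for a one-dimensional `W` (`U(W) = U(1)` compact), each an `↔` (or a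
negation) proved by arithmetic on the weights from the hypothesis `(h : D.Lemma_7_10)` — nothing asserted.
With splitting characters `χ_V = (·/|·|)^{m₀}`, `χ_W = (·/|·|)^{n₀}` they are the printed form of the Fock
bookkeeping for theta one-forms on `U(2,1)` ("vacuum character", "the trivial type occurs iff …", "the type
`𝔭₊` of holomorphic one-forms occurs iff …"):

* `corresponds_trivial_iff_posLine` — `(p,q) = (1,0)`, `s = 0`, `r ≥ 2`: the trivial `U(r)`-type is harmonic iff
  `n₀ = −1`, and then it is paired with the `U(1)`-character `(r + m₀)/2`;
* `corresponds_trivial_iff_negLine` — `(p,q) = (0,1)`: iff `n₀ = +1`, paired with `(m₀ − r)/2`;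
* `corresponds_pPlus_iff_posLine` — `(1,0;2,1)`: `(1,0;−1)` is harmonic iff `n₀ = −1`, paired with the
  `U(1)`-character `(3 + m₀)/2` (parameter `a₁ = 1`);
* `not_corresponds_pPlus_negLine` — `(0,1;2,1)`: `(1,0;−1)` is never harmonic.

Planes (`dim W = 2`) are in `HodgeCM.Literature.IchinoFockKTypesPlanes`.

## References
* A. Ichino, Adv. Math. 398 (2022) 108188, §4.1, §7.5 Lemma 7.10. [Ichino2022ThetaReal]
-/

namespace HodgeCM.Literature.Ichino2022

namespace WorkedLines

open FockHarmonics HarmonicParam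

variable {S : SplittingDatum} (D : FockHarmonics S)

/-- **`(U(1), U(r))`, `r ≥ 2`, positive line against a compact group**: the trivial `K′ = U(r)`-type is
harmonic iff `n₀ = −1`, and then it is paired exactly with the `U(1)`-character of weight `(r + m₀)/2` (the
constants of `𝒫`).  For `r = 3` this is the sentence "in the model of a positive line the vacuum character is
`det^{(m+1)/2}` and `𝟏` occurs iff `m = −1`" of the `U(2,1)` theta-lift bookkeeping.
[cite: Ichino2022ThetaReal, §7.5 Lemma 7.10] -/
theorem corresponds_trivial_iff_posLine (h : D.Lemma_7_10) (hp : S.p = 1) (hq : S.q = 0) (hs : S.s = 0)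
    (hr : 2 ≤ S.r) (μ : KWt S.p S.q) (μ' : KWt S.r S.s) (hμ' : ∀ i, μ'.1 i = 0) :
    D.corresponds μ μ' ↔ S.n₀ = -1 ∧ ∀ i, μ.1 i = ((S.r : ℚ) + S.m₀) / 2 := by
  constructor
  · intro hc
    obtain ⟨P, hμ, hμ'P⟩ := (h _ _).mp hc
    have hPq : P.qp + P.qm ≤ S.q := P.hq
    have hPs : P.pm + P.qp ≤ S.s := P.hs
    have hPp : P.pp + P.pm ≤ S.p := P.hp
    have hqm : P.qm = 0 := by omega
    have hpp : P.pp ≤ 1 := by omega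
    -- entry `1` of `μ′`: `0 = 0 + (p − q)/2 + n₀/2`
    have e1 := hμ' ⟨1, by omega⟩
    rw [hμ'P, mu'_fst_apply, pad_mid _ _ _ _ (by simp; omega) (by simp; omega), hp, hq] at e1
    push_cast at e1
    have hn : (S.n₀ : ℚ) = -1 := by linarith
    have hn' : S.n₀ = -1 := by exact_mod_cast hn
    -- entry `0` of `μ′`: if `p⁺ = 1` it reads `a₀ + 1/2 + n₀/2 = 0`, contradicting `a₀ > 0`
    have hpp0 : P.pp = 0 := by
      by_contra hne
      have hpos : 0 < P.pp := Nat.pos_of_ne_zero hne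
      have e0 := hμ' ⟨0, by omega⟩
      rw [hμ'P, mu'_fst_apply, pad_head _ _ _ _ (by simp; omega), hp, hq, hn] at e0
      have ha : (1 : ℚ) ≤ P.a ⟨0, hpos⟩ := by exact_mod_cast P.a_pos ⟨0, hpos⟩
      push_cast at e0
      linarith
    refine ⟨hn', fun i => ?_⟩
    rw [hμ, mu_fst_apply, pad_mid _ _ _ _ (by omega) (by have := i.isLt; omega), hs]
    push_cast
    ring
  · rintro ⟨hn, hμ⟩
    refine (h _ _).mpr ⟨HarmonicParam.vacuum S, ?_, ?_⟩
    · rw [HarmonicParam.vacuum_mu]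
      ext i
      · rw [hμ i, hs]; push_cast; ring
      · exact (Fin.cast hq i).elim0
    · rw [HarmonicParam.vacuum_mu']
      ext i
      · rw [hμ' i, hp, hq, hn]; push_cast; ring
      · exact (Fin.cast hs i).elim0

/-- **`(U(1), U(r))`, `r ≥ 2`, negative line against a compact group** (`(p,q) = (0,1)`, `s = 0`): the
trivial `U(r)`-type is harmonic iff `n₀ = +1`, and then it is paired with the `U(1)`-character of weight
`(m₀ − r)/2`.  (`r = 3`: "for a negative line … `𝟏` occurs iff `m = +1`".)
[cite: Ichino2022ThetaReal, §7.5 Lemma 7.10] -/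
theorem corresponds_trivial_iff_negLine (h : D.Lemma_7_10) (hp : S.p = 0) (hq : S.q = 1) (hs : S.s = 0)
    (hr : 2 ≤ S.r) (μ : KWt S.p S.q) (μ' : KWt S.r S.s) (hμ' : ∀ i, μ'.1 i = 0) :
    D.corresponds μ μ' ↔ S.n₀ = 1 ∧ ∀ j, μ.2 j = ((S.m₀ : ℚ) - S.r) / 2 := by
  constructor
  · intro hc
    obtain ⟨P, hμ, hμ'P⟩ := (h _ _).mp hc
    have hPq : P.qp + P.qm ≤ S.q := P.hq
    have hPs : P.pm + P.qp ≤ S.s := P.hs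
    have hPp : P.pp + P.pm ≤ S.p := P.hp
    have hpp : P.pp = 0 := by omega
    have hqp : P.qp = 0 := by omega
    have hqm : P.qm ≤ 1 := by omega
    -- entry `0` of `μ′` lies before the `d`-tail (`r ≥ 2 > q⁻`): `0 = (p − q)/2 + n₀/2`
    have e0 := hμ' ⟨0, by omega⟩
    rw [hμ'P, mu'_fst_apply, pad_mid _ _ _ _ (by simp; omega) (by simp; omega), hp, hq] at e0
    push_cast at e0
    have hn : (S.n₀ : ℚ) = 1 := by linarith
    have hn' : S.n₀ = 1 := by exact_mod_cast hn
    -- the last entry: if `q⁻ = 1` it reads `d₀ − 1/2 + n₀/2 = 0`, contradicting `d₀ < 0`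
    have hqm0 : P.qm = 0 := by
      by_contra hne
      have hone : P.qm = 1 := by omega
      have e1 := hμ' ⟨S.r - 1, by omega⟩
      rw [hμ'P, mu'_fst_apply, pad_tail _ _ _ _ (by simp; omega) (by simp; omega), hp, hq, hn] at e1
      have hd : (P.d ⟨S.r - 1 - (S.r - P.qm), by omega⟩ : ℚ) ≤ -1 := by
        have := P.d_neg ⟨S.r - 1 - (S.r - P.qm), by omega⟩
        exact_mod_cast Int.le_sub_one_of_lt this
      push_cast at e1
      linarith
    refine ⟨hn', fun j => ?_⟩
    rw [hμ, mu_snd_apply, pad_mid _ _ _ _ (by omega) (by have := j.isLt; omega), hs]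
    push_cast
    ring
  · rintro ⟨hn, hμ⟩
    refine (h _ _).mpr ⟨HarmonicParam.vacuum S, ?_, ?_⟩
    · rw [HarmonicParam.vacuum_mu]
      ext i
      · exact (Fin.cast hp i).elim0
      · rw [hμ i, hs]; push_cast; ring
    · rw [HarmonicParam.vacuum_mu']
      ext i
      · rw [hμ' i, hp, hq, hn]; push_cast; ring
      · exact (Fin.cast hs i).elim0

/-- **`(U(1), U(2,1))`, positive line** (`(p,q;r,s) = (1,0;2,1)`): the `K′ = U(2) × U(1)`-type
`(1,0;−1)` — the type `𝔭₊ = V⁺ ⊗ (V⁻)^{−1}` of holomorphic one-forms — is harmonic iff `n₀ = −1`, and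
then it is paired exactly with the `U(1)`-character of weight `(3 + m₀)/2` (`a₁ = 1` in Lemma 7.10).
[cite: Ichino2022ThetaReal, §7.5 Lemma 7.10] -/
theorem corresponds_pPlus_iff_posLine (h : D.Lemma_7_10) (hp : S.p = 1) (hq : S.q = 0) (hr : S.r = 2)
    (hs : S.s = 1) (μ : KWt S.p S.q) (μ' : KWt S.r S.s)
    (h0 : μ'.1 ⟨0, by omega⟩ = 1) (h1 : μ'.1 ⟨1, by omega⟩ = 0) (h2 : μ'.2 ⟨0, by omega⟩ = -1) :
    D.corresponds μ μ' ↔ S.n₀ = -1 ∧ ∀ i, μ.1 i = (3 + (S.m₀ : ℚ)) / 2 := by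
  constructor
  · intro hc
    obtain ⟨P, hμ, hμ'P⟩ := (h _ _).mp hc
    have hPq : P.qp + P.qm ≤ S.q := P.hq
    have hPs : P.pm + P.qp ≤ S.s := P.hs
    have hPp : P.pp + P.pm ≤ S.p := P.hp
    have hqm : P.qm = 0 := by omega
    have hqp : P.qp = 0 := by omega
    -- entry `1` of `μ′.1`: `0 = 0 + 1/2 + n₀/2`
    have e1 := h1
    rw [hμ'P, mu'_fst_apply, pad_mid _ _ _ _ (by simp; omega) (by simp; omega), hp, hq] at e1
    push_cast at e1
    have hn : (S.n₀ : ℚ) = -1 := by linarith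
    have hn' : S.n₀ = -1 := by exact_mod_cast hn
    -- entry `0` of `μ′.1`: `1 = a₀ + 1/2 + n₀/2` forces `p⁺ = 1`, `a₀ = 1`
    have hpp : P.pp = 1 := by
      by_contra hne
      have hpp0 : P.pp = 0 := by omega
      have e0 := h0
      rw [hμ'P, mu'_fst_apply, pad_mid _ _ _ _ (by simp; omega) (by simp; omega), hp, hq, hn] at e0
      push_cast at e0
      linarith
    have hpos : 0 < P.pp := by omega
    have e0 := h0
    rw [hμ'P, mu'_fst_apply, pad_head _ _ _ _ (by simp; omega), hp, hq, hn] at e0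
    push_cast at e0
    have ha : (P.a ⟨0, hpos⟩ : ℚ) = 1 := by linarith
    refine ⟨hn', fun i => ?_⟩
    have hi : i.val = 0 := by have := i.isLt; omega
    rw [hμ, mu_fst_apply, pad_head _ _ _ _ (by omega), hr, hs]
    have : P.a ⟨i.val, by omega⟩ = P.a ⟨0, hpos⟩ := by congr 1; exact Fin.ext hi
    rw [this, ha]
    push_cast
    ring
  · rintro ⟨hn, hμ⟩
    -- the parameter `p⁺ = 1`, `a = (1)`, all other strings empty
    let P : HarmonicParam S :=
      { pp := 1, pm := 0, qp := 0, qm := 0, a := fun _ => 1, b := Fin.elim0, c := Fin.elim0, d := Fin.elim0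
        a_anti := fun _ _ _ => le_rfl, b_anti := fun i => i.elim0, c_anti := fun i => i.elim0
        d_anti := fun i => i.elim0, a_pos := fun _ => one_pos, b_neg := fun i => i.elim0
        c_pos := fun i => i.elim0, d_neg := fun i => i.elim0
        hp := by omega, hq := by omega, hr := by omega, hs := by omega }
    refine (h _ _).mpr ⟨P, ?_, ?_⟩
    · ext i
      · have hi : i.val = 0 := by have := i.isLt; omega
        rw [hμ i, mu_fst_apply, pad_head _ _ _ _ (by show i.val < 1; omega), hr, hs]
        push_cast; ring
      · exact (Fin.cast hq i).elim0
    · ext i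
      · rw [mu'_fst_apply, hp, hq, hn]
        have hi : i.val = 0 ∨ i.val = 1 := by have := i.isLt; omega
        rcases hi with hi | hi
        · have : i = ⟨0, by omega⟩ := Fin.ext hi
          rw [this, h0, pad_head _ _ _ _ (by show 0 < 1; omega)]
          push_cast; ring
        · have : i = ⟨1, by omega⟩ := Fin.ext hi
          rw [this, h1, pad_mid _ _ _ _ (by show 1 ≤ 1; omega) (by show 1 < S.r - 0; omega)]
          push_cast; ring
      · rw [mu'_snd_apply, hp, hq, hn]
        have hi : i.val = 0 := by have := i.isLt; omega
        have : i = ⟨0, by omega⟩ := Fin.ext hi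
        rw [this, h2, pad_mid _ _ _ _ (by show 0 ≤ 0; omega) (by show 0 < S.s - 0; omega)]
        push_cast; ring

/-- **`(U(1), U(2,1))`, negative line** (`(p,q;r,s) = (0,1;2,1)`): the type `(1,0;−1) = 𝔭₊` is NEVER
harmonic — a negative line at the place of signature `(2,1)` lifts no holomorphic one-form.
[cite: Ichino2022ThetaReal, §7.5 Lemma 7.10] -/
theorem not_corresponds_pPlus_negLine (h : D.Lemma_7_10) (hp : S.p = 0) (hq : S.q = 1) (hr : S.r = 2)
    (hs : S.s = 1) (μ : KWt S.p S.q) (μ' : KWt S.r S.s)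
    (h0 : μ'.1 ⟨0, by omega⟩ = 1) (h1 : μ'.1 ⟨1, by omega⟩ = 0) (h2 : μ'.2 ⟨0, by omega⟩ = -1) :
    ¬ D.corresponds μ μ' := by
  intro hc
  obtain ⟨P, -, hμ'P⟩ := (h _ _).mp hc
  have hPq : P.qp + P.qm ≤ S.q := P.hq
  have hPs : P.pm + P.qp ≤ S.s := P.hs
  have hPp : P.pp + P.pm ≤ S.p := P.hp
  have hPr : P.pp + P.qm ≤ S.r := P.hr
  have hpp : P.pp = 0 := by omega
  have hpm : P.pm = 0 := by omega
  rcases Nat.lt_or_ge 0 P.qm with hqm | hqm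
  · -- `q⁻ = 1`, `q⁺ = 0`: entry `0` of `μ′.1` is `−1/2 + n₀/2 = 1`, entry `0` of `μ′.2` is `1/2 + n₀/2 = −1`
    have hqp : P.qp = 0 := by omega
    have e0 := h0
    rw [hμ'P, mu'_fst_apply, pad_mid _ _ _ _ (by simp; omega) (by simp; omega), hp, hq] at e0
    have e2 := h2
    rw [hμ'P, mu'_snd_apply, pad_mid _ _ _ _ (by simp; omega) (by simp; omega), hp, hq] at e2
    push_cast at e0 e2
    linarith
  · -- `q⁻ = 0`: entries `0` and `1` of `μ′.1` are both `−1/2 + n₀/2`, but they are `1` and `0`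
    have e0 := h0
    rw [hμ'P, mu'_fst_apply, pad_mid _ _ _ _ (by simp; omega) (by simp; omega), hp, hq] at e0
    have e1 := h1
    rw [hμ'P, mu'_fst_apply, pad_mid _ _ _ _ (by simp; omega) (by simp; omega), hp, hq] at e1
    push_cast at e0 e1
    linarith

end WorkedLines

end HodgeCM.Literature.Ichino2022
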